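import Summits.AtomisticToContinuum.BoseEinsteinCondensation.Theses.BECStronglyRayleigh
import Summits.AtomisticToContinuum.BoseEinsteinCondensation.Theorems.InsertionFieldDelocalisation.Negative.Tightness
import Summits.AtomisticToContinuum.BoseEinsteinCondensation.Theorems.InsertionFieldDelocalisation.Negative.LoadBearing
import Summits.AtomisticToContinuum.BoseEinsteinCondensation.Theorems.BECStronglyRayleighInsertionFieldDelocalisationExcessBoundRowSum
import Summits.AtomisticToContinuum.BoseEinsteinCondensation.Theorems.BECStronglyRayleighInsertionFieldDelocalisationPoExcessBudgetLadder
import Summits.AtomisticToContinuum.BoseEinsteinCondensation.Theorems.BECStronglyRayleighInsertionFieldDelocalisationPoExcessBudgetCounting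
import HarnessLib

/-!
# Stub `stub_poExcessBudget` (line `cosh-budget-penrose-onsager`, crux
# `BECStronglyRayleigh.InsertionFieldDelocalisation`, stmt-AtomisticToContinuum-9673):
# the provable part of the Penrose–Onsager budget, and its reduction to condensation

Supports (does not close) stmt-AtomisticToContinuum-9673. Hard-core bosons on `(ℤ/Lℤ)³` = the
spin-½ XY model `H = xyTorus 3 L 1` (occupied = index `0`, hopping `-½`), `E(k)` the ground energy of
`k` bosons, `ψ = ψ_N ≥ 0` a sector-`N` ground vector, `Φ = A†ψ = Ŝ⁺ψ` the Penrose–Onsager insertion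
(the crux's `poVec ψ`), `χ = Aψ = Ŝ⁻ψ` the removal. The registered stub asks for the ABSOLUTE budget
`Re⟨Φ, HΦ⟩ - E(N+1)‖Φ‖² ≤ (C_B/L³)‖Φ‖²` uniformly in `1 ≤ N`, `2(N+1) ≤ L³`.

What is proved here (kernel-checked; the only hypotheses are the two named statements):

* `cb4ex_poExcess_core` : from the f-sum rule `[Ŝ⁻,[H,Ŝ⁺]] = -4 Σ SᶻSᶻ - 2H` and the exact
  insertion–removal identity (helper file `…PoExcessBudgetLadder`), the variational principle for `χ`
  in sector `N - 1`, `‖Φ‖² = ‖χ‖² + (L³ - 2N)‖ψ‖²`, `4⟨ψ, ΣSᶻSᶻ ψ⟩ ≥ (3L³ - 12N)‖ψ‖²`, `‖χ‖² ≥ N‖ψ‖²`,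
  `E(0) ≤ 0` (helper file `…PoExcessBudgetCounting`), `E(k) ≥ -3k` (row sums, `…ExcessBoundRowSum`)
  and CONVEXITY of `k ↦ E(k)` (hypothesis; = the statement of `stub_convexity` of line
  `mobile-trap-dirichlet-eigenfunction`): `Re⟨Φ, HΦ⟩ - E(N+1)‖Φ‖² ≤ 12 N ‖ψ‖²`.
  Behind it is the exact two-sided identity
  `exc_ins + exc_rem = (2E(N) - E(N+1) - E(N-1))‖χ‖² + [6N - 2E(N) - 4⟨B⟩ - δ_{N+1}(L³ - 2N)]‖ψ‖²`
  (`exc_rem = ⟨χ, Hχ⟩ - E(N-1)‖χ‖² ≥ 0`, `B` = number of occupied bonds, `δ_{N+1} = E(N+1) - E(N) + 3 ≥ 0`).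
* `cb4ex_poExcess_le_linear` = registered sub-goal `stub_poExcessBudgetLinear` : hence the WEAK
  budget `Re⟨Φ, HΦ⟩ - E(N+1)‖Φ‖² ≤ (24 N / L³) ‖Φ‖²` (the unconditional-up-to-convexity `O(N/L³)`).
* `cb4ex_poExcessBudget_of_condensation` = registered sub-goal `stub_poExcessBudgetOfCondensation` :
  convexity AND a uniform condensate lower bound `‖Aψ_N‖² = L³⟨ψ_N, a₀†a₀ ψ_N⟩ ≥ c N L³ ‖ψ_N‖²`
  (`L ≥ 3`, `2(N+1) ≤ L³`) imply the REGISTERED statement verbatim, with `C_B = 12/c`.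

Diagnosis (why the registered `O(L⁻³)` itself is not closed here): `‖Φ‖² = (L³N₀ + L³ - 2N)‖ψ‖²`
with `N/L³ ≤ N₀ = ⟨a₀†a₀⟩ ≤ N`, while in the two-sided identity the right side is, heuristically at low
density, `≈ (12 - 4πa)N - 4πa N₀` with `4πa ≈ 3.96` (`a ≈ 0.315`, the hard-core lattice scattering
length at hopping `½`), i.e. `Θ(N)‖ψ‖² > 0`. So an `O(L⁻³)‖Φ‖²` insertion budget forces either
`N₀ ≳ N` (Bose–Einstein condensation of the hard-core lattice gas at filling `≤ ½`, open off half
filling, LSSY 2005 Ch. 11) or that the REMOVAL excess `exc_rem` absorbs all but `O(1 + N₀)‖ψ‖²` of a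
`Θ(N)‖ψ‖²` total — a statement of the same condensation strength about `Aψ_N`. The missing
statement is recorded as the hypothesis `hbec` of `cb4ex_poExcessBudget_of_condensation`; given it
(and convexity, the mobile-trap line's `stub_convexity`) the registered stub follows by
`stub_poExcessBudgetOfCondensation`.
[folklore]
-/

noncomputable section

namespace Summit.AtomisticToContinuum.BoseEinsteinCondensation.Cruxes.InsertionFieldDelocalisation.CoshBudgetPenroseOnsager

open scoped BigOperators ComplexOrder
open Literature.MathematicalPhysics.QuantumLattice Literature.Probability.LatticeModels Matrix Finset Complex
open Summit.AtomisticToContinuum.BoseEinsteinCondensation.Theses.BECStronglyRayleigh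
open Summit.AtomisticToContinuum.BoseEinsteinCondensation.Theorems.InsertionFieldDelocalisation.Negative
open Summit.AtomisticToContinuum.BoseEinsteinCondensation.Cruxes.InsertionFieldDelocalisation.MobileTrapDirichletEigenfunction
  (mt2ex_E_lower mt2ex_re_star_dotProduct_self)

/-! ### Arithmetic of the budget -/

/-- The linear-arithmetic core of the budget: the f-sum identity, the removal variational bound,
the norm identity, the `SᶻSᶻ` bound, convexity, `E(N+1) ≥ E(N) - 3` and `E(N) ≥ -3N` give
`exc_ins ≤ 12 N ‖ψ‖²`. [folklore] -/
theorem cb4ex_budget_arith {a b p m z s E EP EM V N : ℝ}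
    (hid : a + b = E * (p + m) + 4 * (-1) * z - 2 * E * s) (hvar : EM * m ≤ b)
    (hnorm : m = p + 2 * (N - V / 2) * s) (hzz : (3 * V - 12 * N) * s ≤ 4 * z)
    (hconvx : 2 * E ≤ EP + EM) (hchem : E - EP ≤ 3) (hβ : -(3 * N) ≤ E)
    (hm : 0 ≤ m) (hs : 0 ≤ s) (hVN : 2 * N ≤ V) :
    a - EP * p ≤ 12 * N * s := by
  have hp : p = m + (V - 2 * N) * s := by linarith
  subst hp
  have h1 : 0 ≤ (EP + EM - 2 * E) * m := mul_nonneg (by linarith) hm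
  have h2 : 0 ≤ (3 - (E - EP)) * ((V - 2 * N) * s) :=
    mul_nonneg (by linarith) (mul_nonneg (by linarith) hs)
  have h3 : 0 ≤ (E + 3 * N) * s := mul_nonneg (by linarith) hs
  nlinarith [h1, h2, h3, hid, hvar, hzz]

/-! ### The core estimate -/

/-- **Core of the Penrose–Onsager budget.** For `L ≥ 3`, `1 ≤ N`, `2(N+1) ≤ L³`, a nonnegative
sector-`N` ground vector `ψ` of `H = xyTorus 3 L 1` and convex sector energies:
`Re⟨Ŝ⁺ψ, HŜ⁺ψ⟩ - E(N+1)‖Ŝ⁺ψ‖² ≤ 12N‖ψ‖²`, `‖Ŝ⁻ψ‖² + (L³ - 2N)‖ψ‖² = ‖Ŝ⁺ψ‖²` and `N‖ψ‖² ≤ ‖Ŝ⁻ψ‖²`.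
[folklore] -/
theorem cb4ex_poExcess_core
    (hconv : ∀ (L : ℕ) [NeZero L], 2 ≤ L → ∀ N : ℕ, 1 ≤ N → N + 1 ≤ L ^ 3 →
      2 * lowestEnergyInSector 1 (xyTorus 3 L 1) ((N : ℝ) - (L : ℝ) ^ 3 / 2) ≤
        lowestEnergyInSector 1 (xyTorus 3 L 1) (((N + 1 : ℕ) : ℝ) - (L : ℝ) ^ 3 / 2) +
          lowestEnergyInSector 1 (xyTorus 3 L 1) (((N - 1 : ℕ) : ℝ) - (L : ℝ) ^ 3 / 2))
    (L : ℕ) [NeZero L] (hL : 3 ≤ L) (N : ℕ) (hN : 1 ≤ N) (hNL : 2 * (N + 1) ≤ L ^ 3)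
    (ψ : TensorIndex (TorusSite 3 L) 2 → ℂ)
    (hsec : ψ ∈ spinZSector 1 ((N : ℝ) - (L : ℝ) ^ 3 / 2))
    (heig : (xyTorus 3 L 1).mulVec ψ =
      ((lowestEnergyInSector 1 (xyTorus 3 L 1) ((N : ℝ) - (L : ℝ) ^ 3 / 2) : ℝ) : ℂ) • ψ)
    (hnn : ∀ σ, 0 ≤ (ψ σ).re ∧ (ψ σ).im = 0) :
    (star ((totalSpin 1 0 + I • totalSpin 1 1 : Op (TorusSite 3 L) 2) *ᵥ ψ) ⬝ᵥ
          (xyTorus 3 L 1) *ᵥ ((totalSpin 1 0 + I • totalSpin 1 1 : Op (TorusSite 3 L) 2) *ᵥ ψ)).re -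
        lowestEnergyInSector 1 (xyTorus 3 L 1) (((N + 1 : ℕ) : ℝ) - (L : ℝ) ^ 3 / 2) *
          (star ((totalSpin 1 0 + I • totalSpin 1 1 : Op (TorusSite 3 L) 2) *ᵥ ψ) ⬝ᵥ
            ((totalSpin 1 0 + I • totalSpin 1 1 : Op (TorusSite 3 L) 2) *ᵥ ψ)).re ≤
        12 * (N : ℝ) * (star ψ ⬝ᵥ ψ).re ∧
      (star ((totalSpin 1 0 - I • totalSpin 1 1 : Op (TorusSite 3 L) 2) *ᵥ ψ) ⬝ᵥ
            ((totalSpin 1 0 - I • totalSpin 1 1 : Op (TorusSite 3 L) 2) *ᵥ ψ)).re +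
          ((L : ℝ) ^ 3 - 2 * N) * (star ψ ⬝ᵥ ψ).re =
        (star ((totalSpin 1 0 + I • totalSpin 1 1 : Op (TorusSite 3 L) 2) *ᵥ ψ) ⬝ᵥ
          ((totalSpin 1 0 + I • totalSpin 1 1 : Op (TorusSite 3 L) 2) *ᵥ ψ)).re ∧
      (N : ℝ) * (star ψ ⬝ᵥ ψ).re ≤
        (star ((totalSpin 1 0 - I • totalSpin 1 1 : Op (TorusSite 3 L) 2) *ᵥ ψ) ⬝ᵥ
          ((totalSpin 1 0 - I • totalSpin 1 1 : Op (TorusSite 3 L) 2) *ᵥ ψ)).re := by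
  have hNle : N ≤ L ^ 3 := by omega
  have hcard : Fintype.card (TorusSite 3 L) = L ^ 3 := card_torusSite 3 L
  -- the sector in cardinality form
  have hsec' : ψ ∈ spinZSector 1 ((N : ℝ) - (Fintype.card (TorusSite 3 L) : ℝ) / 2) := by
    rw [hcard]; push_cast; exact hsec
  -- sector energies
  set Es : ℕ → ℝ := fun k => lowestEnergyInSector 1 (xyTorus 3 L 1) ((k : ℝ) - (L : ℝ) ^ 3 / 2) with hEs
  have hE : lowestEnergyInSector 1 (xyTorus 3 L 1) ((N : ℝ) - (L : ℝ) ^ 3 / 2) = Es N := rfl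
  have hEP : lowestEnergyInSector 1 (xyTorus 3 L 1) (((N + 1 : ℕ) : ℝ) - (L : ℝ) ^ 3 / 2) = Es (N + 1) := rfl
  have hEM : lowestEnergyInSector 1 (xyTorus 3 L 1) (((N - 1 : ℕ) : ℝ) - (L : ℝ) ^ 3 / 2) = Es (N - 1) := rfl
  -- (β) row sums, and `E(0) ≤ 0`
  have hβ : -(3 * (N : ℝ)) ≤ Es N := mt2ex_E_lower L (by omega) N hNle
  have hβP : -(3 * ((N + 1 : ℕ) : ℝ)) ≤ Es (N + 1) := mt2ex_E_lower L (by omega) (N + 1) (by omega)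
  have hE0 : Es 0 ≤ 0 := by
    have h := cb4ex_sectorEnergy_zero_le (torusGraph 3 L) (-1) (((0 : ℕ) : ℝ) - (L : ℝ) ^ 3 / 2)
      (by rw [hcard]; push_cast; ring)
    exact h
  -- convexity ⇒ `E(N+1) - E(N) ≥ -3`
  have hconv' : ∀ k : ℕ, 1 ≤ k → k + 1 ≤ L ^ 3 → 2 * Es k ≤ Es (k + 1) + Es (k - 1) :=
    fun k hk hkV => hconv L (by omega) k hk hkV
  have hchem : Es N - Es (N + 1) ≤ 3 := by
    have h := cb4ex_chemPotential_ge Es (L ^ 3) hconv' (N + 1) (by omega) (by omega)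
    rw [Nat.add_sub_cancel] at h
    have hN1 : (0 : ℝ) < ((N + 1 : ℕ) : ℝ) := by positivity
    have h3 : -(3 * ((N + 1 : ℕ) : ℝ)) ≤ ((N + 1 : ℕ) : ℝ) * (Es (N + 1) - Es N) := by linarith
    have h4 : -3 ≤ Es (N + 1) - Es N := by
      by_contra hc
      push Not at hc
      have : ((N + 1 : ℕ) : ℝ) * (Es (N + 1) - Es N) < ((N + 1 : ℕ) : ℝ) * (-3) :=
        mul_lt_mul_of_pos_left hc hN1
      linarith
    linarith
  have hconvN : 2 * Es N ≤ Es (N + 1) + Es (N - 1) := hconv' N hN (by omega)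
  -- the f-sum identity
  have hid := cb4ex_insertion_removal_identity_re 1 (torusGraph 3 L) (-1) heig
  -- the removal vector lies in sector `N - 1`; variational principle there
  have hsecW : ψ ∈ spinZSector 1
      (((Fintype.card (TorusSite 3 L) * 1 : ℕ) : ℝ) / 2 - ((L ^ 3 - N : ℕ) : ℝ)) := by
    convert hsec using 2
    rw [hcard, Nat.cast_sub hNle]; push_cast; ring
  have hMmem : (totalSpin 1 0 - I • totalSpin 1 1 : Op (TorusSite 3 L) 2) *ᵥ ψ ∈
      spinZSector 1 (((N - 1 : ℕ) : ℝ) - (L : ℝ) ^ 3 / 2) := by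
    have h := LiebMattis.lower_mulVec_mem (n := 1) hsecW
    convert h using 2
    rw [hcard, Nat.cast_sub hN]; push_cast; rw [Nat.cast_sub hNle]; push_cast; ring
  have hvar := cb4ex_sectorEnergy_mul_norm_le (torusGraph 3 L) (-1) _ hMmem
  -- the norm identity, the `SᶻSᶻ` bound, `‖Ŝ⁻ψ‖² ≥ N‖ψ‖²`
  have hnorm := LiebMattis.re_norm_lower_eq (n := 1) hsec
  have hzz := cb4ex_zz_lower L hL N ψ hsec
  have hlow := cb4ex_norm_lower_ge hsec' hnn
  have hm : 0 ≤ (star ((totalSpin 1 0 - I • totalSpin 1 1 : Op (TorusSite 3 L) 2) *ᵥ ψ) ⬝ᵥ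
      ((totalSpin 1 0 - I • totalSpin 1 1 : Op (TorusSite 3 L) 2) *ᵥ ψ)).re := by
    rw [mt2ex_re_star_dotProduct_self]; positivity
  have hs : 0 ≤ (star ψ ⬝ᵥ ψ).re := by rw [mt2ex_re_star_dotProduct_self]; positivity
  have hVN : 2 * (N : ℝ) ≤ (L : ℝ) ^ 3 := by exact_mod_cast (show 2 * N ≤ L ^ 3 by omega)
  refine ⟨?_, by linarith, hlow⟩
  rw [hEP]
  push_cast at hβP hid
  exact cb4ex_budget_arith hid hvar hnorm hzz hconvN hchem hβ hm hs hVN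

/-! ### The weak (linear in the filling) budget -/

/-- **The provable Penrose–Onsager budget, `O(N/L³)`.** If the sector ground energies of
`xyTorus 3 L 1` are convex in the particle number (the statement of `stub_convexity` of line
`mobile-trap-dirichlet-eigenfunction`), then for `L ≥ 3`, `1 ≤ N`, `2(N+1) ≤ L³` and every admissible
level-`N` datum `ψ'`, the Penrose–Onsager vector `Φ = poVec ψ'` has variational excess
`Re⟨Φ, HΦ⟩ - E(N+1) Re⟨Φ, Φ⟩ ≤ (24 N / L³) Re⟨Φ, Φ⟩`. [folklore] -/
theorem cb4ex_poExcess_le_linear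
    (hconv : ∀ (L : ℕ) [NeZero L], 2 ≤ L → ∀ N : ℕ, 1 ≤ N → N + 1 ≤ L ^ 3 →
      2 * lowestEnergyInSector 1 (xyTorus 3 L 1) ((N : ℝ) - (L : ℝ) ^ 3 / 2) ≤
        lowestEnergyInSector 1 (xyTorus 3 L 1) (((N + 1 : ℕ) : ℝ) - (L : ℝ) ^ 3 / 2) +
          lowestEnergyInSector 1 (xyTorus 3 L 1) (((N - 1 : ℕ) : ℝ) - (L : ℝ) ^ 3 / 2)) :
    ∀ (L : ℕ) [NeZero L], 3 ≤ L → ∀ N : ℕ, 1 ≤ N → 2 * (N + 1) ≤ L ^ 3 →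
      ∀ ψ' : TensorIndex (TorusSite 3 L) 2 → ℂ,
        (ψ' ∈ spinZSector 1 (((N : ℕ) : ℝ) - (L : ℝ) ^ 3 / 2) ∧ ψ' ≠ 0 ∧
          (xyTorus 3 L 1).mulVec ψ' =
            ((lowestEnergyInSector 1 (xyTorus 3 L 1) (((N : ℕ) : ℝ) - (L : ℝ) ^ 3 / 2) : ℝ) : ℂ) • ψ' ∧
          ∀ σ, 0 ≤ (ψ' σ).re ∧ (ψ' σ).im = 0) →
        (star ((fun σ => ∑ x, if σ x = 0 then (ψ') (Function.update σ x 1) else 0)) ⬝ᵥ (xyTorus 3 L 1).mulVec ((fun σ => ∑ x, if σ x = 0 then (ψ') (Function.update σ x 1) else 0))).re - lowestEnergyInSector 1 (xyTorus 3 L 1) (((N + 1 : ℕ) : ℝ) - (L : ℝ) ^ 3 / 2) * (star ((fun σ => ∑ x, if σ x = 0 then (ψ') (Function.update σ x 1) else 0)) ⬝ᵥ ((fun σ => ∑ x, if σ x = 0 then (ψ') (Function.update σ x 1) else 0))).re ≤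
          24 * (N : ℝ) / (L : ℝ) ^ 3 * (star ((fun σ => ∑ x, if σ x = 0 then (ψ') (Function.update σ x 1) else 0)) ⬝ᵥ ((fun σ => ∑ x, if σ x = 0 then (ψ') (Function.update σ x 1) else 0))).re := by
  intro L _ hL N hN hNL ψ' ⟨hsec, _, heig, hnn⟩
  have hpo : (fun σ => ∑ x, if σ x = 0 then (ψ') (Function.update σ x 1) else 0) =
      (totalSpin 1 0 + I • totalSpin 1 1 : Op (TorusSite 3 L) 2) *ᵥ ψ' := by
    funext σ; exact (cb4ex_raise_mulVec_apply_two ψ' σ).symm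
  rw [hpo]
  obtain ⟨h1, h2, h3⟩ := cb4ex_poExcess_core hconv L hL N hN hNL ψ' hsec heig hnn
  have hs : 0 ≤ (star ψ' ⬝ᵥ ψ').re := by rw [mt2ex_re_star_dotProduct_self]; positivity
  have hV : (0 : ℝ) < (L : ℝ) ^ 3 := by positivity
  have hVN : 2 * ((N : ℝ) + 1) ≤ (L : ℝ) ^ 3 := by exact_mod_cast hNL
  have hN0 : (0 : ℝ) ≤ N := Nat.cast_nonneg N
  refine h1.trans ?_
  rw [div_mul_eq_mul_div, le_div_iff₀ hV]
  nlinarith [h2, h3, hs, hVN, hN0, mul_nonneg hN0 hs]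

/-! ### The registered budget from condensation -/

/-- **The registered `O(L⁻³)` Penrose–Onsager budget follows from convexity and condensation.**
If the sector ground energies are convex in the particle number (`stub_convexity`) and the
nonnegative sector ground vectors condense uniformly — `‖Aψ_N‖² = L³⟨ψ_N, a₀†a₀ ψ_N⟩ ≥ c N L³ ‖ψ_N‖²`
for `L ≥ 3`, `2(N+1) ≤ L³` (`A = Ŝ⁻`, written in the occupation basis; the MISSING statement of this
line, Bose–Einstein condensation of the hard-core lattice gas at filling `≤ ½`) — then the registered
`stub_poExcessBudget` holds with `C_B = 12/c`: `Re⟨Φ, HΦ⟩ - E(N+1)‖Φ‖² ≤ 12N‖ψ‖² ≤ (12/(cL³))‖Aψ‖²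
≤ (12/(cL³))‖Φ‖²`. [folklore] -/
theorem cb4ex_poExcessBudget_of_condensation
    (hconv : ∀ (L : ℕ) [NeZero L], 2 ≤ L → ∀ N : ℕ, 1 ≤ N → N + 1 ≤ L ^ 3 →
      2 * lowestEnergyInSector 1 (xyTorus 3 L 1) ((N : ℝ) - (L : ℝ) ^ 3 / 2) ≤
        lowestEnergyInSector 1 (xyTorus 3 L 1) (((N + 1 : ℕ) : ℝ) - (L : ℝ) ^ 3 / 2) +
          lowestEnergyInSector 1 (xyTorus 3 L 1) (((N - 1 : ℕ) : ℝ) - (L : ℝ) ^ 3 / 2))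
    (hbec : ∃ c : ℝ, 0 < c ∧ ∀ (L : ℕ) [NeZero L], 3 ≤ L → ∀ N : ℕ, 1 ≤ N → 2 * (N + 1) ≤ L ^ 3 →
      ∀ ψ' : TensorIndex (TorusSite 3 L) 2 → ℂ,
        (ψ' ∈ spinZSector 1 (((N : ℕ) : ℝ) - (L : ℝ) ^ 3 / 2) ∧ ψ' ≠ 0 ∧
          (xyTorus 3 L 1).mulVec ψ' =
            ((lowestEnergyInSector 1 (xyTorus 3 L 1) (((N : ℕ) : ℝ) - (L : ℝ) ^ 3 / 2) : ℝ) : ℂ) • ψ' ∧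
          ∀ σ, 0 ≤ (ψ' σ).re ∧ (ψ' σ).im = 0) →
        c * N * (L : ℝ) ^ 3 * (star ψ' ⬝ᵥ ψ').re ≤
          (star ((fun σ => ∑ x, if σ x = 1 then (ψ') (Function.update σ x 0) else 0)) ⬝ᵥ ((fun σ => ∑ x, if σ x = 1 then (ψ') (Function.update σ x 0) else 0))).re) :
    ∃ C_B : ℝ, 0 ≤ C_B ∧ ∀ (L : ℕ) [NeZero L], 3 ≤ L → ∀ N : ℕ, 1 ≤ N → 2 * (N + 1) ≤ L ^ 3 →
      ∀ ψ' : TensorIndex (TorusSite 3 L) 2 → ℂ,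
        (ψ' ∈ spinZSector 1 (((N : ℕ) : ℝ) - (L : ℝ) ^ 3 / 2) ∧ ψ' ≠ 0 ∧
          (xyTorus 3 L 1).mulVec ψ' =
            ((lowestEnergyInSector 1 (xyTorus 3 L 1) (((N : ℕ) : ℝ) - (L : ℝ) ^ 3 / 2) : ℝ) : ℂ) • ψ' ∧
          ∀ σ, 0 ≤ (ψ' σ).re ∧ (ψ' σ).im = 0) →
        (star ((fun σ => ∑ x, if σ x = 0 then (ψ') (Function.update σ x 1) else 0)) ⬝ᵥ (xyTorus 3 L 1).mulVec ((fun σ => ∑ x, if σ x = 0 then (ψ') (Function.update σ x 1) else 0))).re - lowestEnergyInSector 1 (xyTorus 3 L 1) (((N + 1 : ℕ) : ℝ) - (L : ℝ) ^ 3 / 2) * (star ((fun σ => ∑ x, if σ x = 0 then (ψ') (Function.update σ x 1) else 0)) ⬝ᵥ ((fun σ => ∑ x, if σ x = 0 then (ψ') (Function.update σ x 1) else 0))).re ≤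
          C_B / (L : ℝ) ^ 3 * (star ((fun σ => ∑ x, if σ x = 0 then (ψ') (Function.update σ x 1) else 0)) ⬝ᵥ ((fun σ => ∑ x, if σ x = 0 then (ψ') (Function.update σ x 1) else 0))).re := by
  obtain ⟨c, hc, hbec⟩ := hbec
  refine ⟨12 / c, by positivity, fun L _ hL N hN hNL ψ' hG => ?_⟩
  have hcond := hbec L hL N hN hNL ψ' hG
  obtain ⟨hsec, _, heig, hnn⟩ := hG
  have hpo : (fun σ => ∑ x, if σ x = 0 then (ψ') (Function.update σ x 1) else 0) =
      (totalSpin 1 0 + I • totalSpin 1 1 : Op (TorusSite 3 L) 2) *ᵥ ψ' := by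
    funext σ; exact (cb4ex_raise_mulVec_apply_two ψ' σ).symm
  have hrm : (fun σ => ∑ x, if σ x = 1 then (ψ') (Function.update σ x 0) else 0) =
      (totalSpin 1 0 - I • totalSpin 1 1 : Op (TorusSite 3 L) 2) *ᵥ ψ' := by
    funext σ; exact (cb4ex_lower_mulVec_apply_two ψ' σ).symm
  rw [hrm] at hcond
  rw [hpo]
  obtain ⟨h1, h2, -⟩ := cb4ex_poExcess_core hconv L hL N hN hNL ψ' hsec heig hnn
  have hs : 0 ≤ (star ψ' ⬝ᵥ ψ').re := by rw [mt2ex_re_star_dotProduct_self]; positivity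
  have hV : (0 : ℝ) < (L : ℝ) ^ 3 := by positivity
  have hVN : 2 * ((N : ℝ) + 1) ≤ (L : ℝ) ^ 3 := by exact_mod_cast hNL
  have hN0 : (0 : ℝ) ≤ N := Nat.cast_nonneg N
  refine h1.trans ?_
  rw [div_div, div_mul_eq_mul_div, le_div_iff₀ (by positivity)]
  nlinarith [h2, hcond, hs, hVN, hN0, mul_nonneg hN0 hs, hc]

/-! ### Registered sub-goals -/

/-- **Registered sub-goal `stub_poExcessBudgetLinear`** (helper of `stub_poExcessBudget`, line
`cosh-budget-penrose-onsager`): convexity of the sector energies implies the `O(N/L³)` Penrose–Onsager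
budget `Re⟨Φ, HΦ⟩ - E(N+1)‖Φ‖² ≤ (24N/L³)‖Φ‖²` for `Φ = poVec ψ'`. [folklore] -/
theorem stub_poExcessBudgetLinear :
    (∀ (L : ℕ) [NeZero L], 2 ≤ L → ∀ N : ℕ, 1 ≤ N → N + 1 ≤ L ^ 3 → 2 * lowestEnergyInSector 1
      (xyTorus 3 L 1) ((N : ℝ) - (L : ℝ) ^ 3 / 2) ≤ lowestEnergyInSector 1 (xyTorus 3 L 1) (((N + 1 :
      ℕ) : ℝ) - (L : ℝ) ^ 3 / 2) + lowestEnergyInSector 1 (xyTorus 3 L 1) (((N - 1 : ℕ) : ℝ) - (L : ℝ)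
      ^ 3 / 2)) → ∀ (L : ℕ) [NeZero L], 3 ≤ L → ∀ N : ℕ, 1 ≤ N → 2 * (N + 1) ≤ L ^ 3 → ∀ ψ' :
      TensorIndex (TorusSite 3 L) 2 → ℂ, (ψ' ∈ spinZSector 1 (((N : ℕ) : ℝ) - (L : ℝ) ^ 3 / 2) ∧ ψ' ≠
      0 ∧ (xyTorus 3 L 1).mulVec ψ' = ((lowestEnergyInSector 1 (xyTorus 3 L 1) (((N : ℕ) : ℝ) - (L :
      ℝ) ^ 3 / 2) : ℝ) : ℂ) • ψ' ∧ ∀ σ, 0 ≤ (ψ' σ).re ∧ (ψ' σ).im = 0) → (star ((fun σ => ∑ x, if σ x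
      = 0 then (ψ') (Function.update σ x 1) else 0)) ⬝ᵥ (xyTorus 3 L 1).mulVec ((fun σ => ∑ x, if σ x
      = 0 then (ψ') (Function.update σ x 1) else 0))).re - lowestEnergyInSector 1 (xyTorus 3 L 1) (((N
      + 1 : ℕ) : ℝ) - (L : ℝ) ^ 3 / 2) * (star ((fun σ => ∑ x, if σ x = 0 then (ψ') (Function.update σ
      x 1) else 0)) ⬝ᵥ ((fun σ => ∑ x, if σ x = 0 then (ψ') (Function.update σ x 1) else 0))).re ≤ 24
      * (N : ℝ) / (L : ℝ) ^ 3 * (star ((fun σ => ∑ x, if σ x = 0 then (ψ') (Function.update σ x 1)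
      else 0)) ⬝ᵥ ((fun σ => ∑ x, if σ x = 0 then (ψ') (Function.update σ x 1) else 0))).re :=
  fun hconv L _ hL N hN hNL ψ' hG => cb4ex_poExcess_le_linear hconv L hL N hN hNL ψ' hG

/-- **Registered sub-goal `stub_poExcessBudgetOfCondensation`** (helper of `stub_poExcessBudget`,
line `cosh-budget-penrose-onsager`): convexity of the sector energies and uniform condensation
`‖Aψ_N‖² ≥ c N L³ ‖ψ_N‖²` of the nonnegative sector ground vectors imply the registered `O(L⁻³)`
budget (with `C_B = 12/c`). [folklore] -/
theorem stub_poExcessBudgetOfCondensation :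
    (∀ (L : ℕ) [NeZero L], 2 ≤ L → ∀ N : ℕ, 1 ≤ N → N + 1 ≤ L ^ 3 → 2 * lowestEnergyInSector 1
      (xyTorus 3 L 1) ((N : ℝ) - (L : ℝ) ^ 3 / 2) ≤ lowestEnergyInSector 1 (xyTorus 3 L 1) (((N + 1 :
      ℕ) : ℝ) - (L : ℝ) ^ 3 / 2) + lowestEnergyInSector 1 (xyTorus 3 L 1) (((N - 1 : ℕ) : ℝ) - (L : ℝ)
      ^ 3 / 2)) → (∃ c : ℝ, 0 < c ∧ ∀ (L : ℕ) [NeZero L], 3 ≤ L → ∀ N : ℕ, 1 ≤ N → 2 * (N + 1) ≤ L ^ 3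
      → ∀ ψ' : TensorIndex (TorusSite 3 L) 2 → ℂ, (ψ' ∈ spinZSector 1 (((N : ℕ) : ℝ) - (L : ℝ) ^ 3 /
      2) ∧ ψ' ≠ 0 ∧ (xyTorus 3 L 1).mulVec ψ' = ((lowestEnergyInSector 1 (xyTorus 3 L 1) (((N : ℕ) :
      ℝ) - (L : ℝ) ^ 3 / 2) : ℝ) : ℂ) • ψ' ∧ ∀ σ, 0 ≤ (ψ' σ).re ∧ (ψ' σ).im = 0) → c * N * (L : ℝ) ^ 3
      * (star ψ' ⬝ᵥ ψ').re ≤ (star ((fun σ => ∑ x, if σ x = 1 then (ψ') (Function.update σ x 0) else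
      0)) ⬝ᵥ ((fun σ => ∑ x, if σ x = 1 then (ψ') (Function.update σ x 0) else 0))).re) → ∃ C_B : ℝ, 0
      ≤ C_B ∧ ∀ (L : ℕ) [NeZero L], 3 ≤ L → ∀ N : ℕ, 1 ≤ N → 2 * (N + 1) ≤ L ^ 3 → ∀ ψ' : TensorIndex
      (TorusSite 3 L) 2 → ℂ, (ψ' ∈ spinZSector 1 (((N : ℕ) : ℝ) - (L : ℝ) ^ 3 / 2) ∧ ψ' ≠ 0 ∧ (xyTorus
      3 L 1).mulVec ψ' = ((lowestEnergyInSector 1 (xyTorus 3 L 1) (((N : ℕ) : ℝ) - (L : ℝ) ^ 3 / 2) :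
      ℝ) : ℂ) • ψ' ∧ ∀ σ, 0 ≤ (ψ' σ).re ∧ (ψ' σ).im = 0) → (star ((fun σ => ∑ x, if σ x = 0 then (ψ')
      (Function.update σ x 1) else 0)) ⬝ᵥ (xyTorus 3 L 1).mulVec ((fun σ => ∑ x, if σ x = 0 then (ψ')
      (Function.update σ x 1) else 0))).re - lowestEnergyInSector 1 (xyTorus 3 L 1) (((N + 1 : ℕ) : ℝ)
      - (L : ℝ) ^ 3 / 2) * (star ((fun σ => ∑ x, if σ x = 0 then (ψ') (Function.update σ x 1) else 0))
      ⬝ᵥ ((fun σ => ∑ x, if σ x = 0 then (ψ') (Function.update σ x 1) else 0))).re ≤ C_B / (L : ℝ) ^ 3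
      * (star ((fun σ => ∑ x, if σ x = 0 then (ψ') (Function.update σ x 1) else 0)) ⬝ᵥ ((fun σ => ∑ x,
      if σ x = 0 then (ψ') (Function.update σ x 1) else 0))).re :=
  fun hconv hbec => cb4ex_poExcessBudget_of_condensation hconv hbec

end Summit.AtomisticToContinuum.BoseEinsteinCondensation.Cruxes.InsertionFieldDelocalisation.CoshBudgetPenroseOnsager

end
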